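import Mathlib
import Summits.ValiantsHypothesis.ValiantsHypothesis.Theses.FreeFermionCLL

/-!
# Route FreeFermionCLL — `CubicReadOnce` (stmt-ValiantsHypothesis-13562)

`[deg 3] det(I₉ + diag(x)·A₃) = 2·per₃`, where `A₃(e,e') = 1` iff the cells `e, e'` of the
`3 × 3` board share neither row nor column (and `0` otherwise, in particular on the diagonal).

The proof is the principal-minor expansion
`det(1 + diag(d)·A) = ∑_S (∏_{i∈S} d i) · det A[S]` (multilinearity of `det` in the rows, then a
block-triangular determinant), followed by the evaluation of the `3 × 3` principal minors of the
zero-diagonal symmetric `0/1` matrix `A₃`: such a minor is the sum of its two directed `3`-cycles,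
i.e. `2` if the three cells are pairwise non-attacking (a transversal of the board) and `0`
otherwise; the transversals are exactly the graphs of the six permutations of `Fin 3`.

Main statements:
* `det_one_add_diagonal_mul_eq_sum_minors` — the principal-minor expansion (general commutative
  ring, general finite index type);
* `det_minor_three` — the `3 × 3` principal minors of the board kernel;
* `homogeneousComponent_three_det_eq`, `cubicReadOnce_proof : CubicReadOnce`.
-/

-- `Summit.ValiantsHypothesis.ValiantsHypothesis.…` is the tree's mandated single-conjunct layout (Sub = Summit).
set_option linter.dupNamespace false

namespace Summit.ValiantsHypothesis.ValiantsHypothesis.Theorems.FreeFermionCLLCubicReadOnce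

open MvPolynomial Finset

section PrincipalMinorExpansion

variable {ι R : Type*} [Fintype ι] [DecidableEq ι] [CommRing R]

/-- **Principal-minor expansion, row-piecewise form.** For a diagonal matrix `diag d`,
`det(1 + diag(d)·A) = ∑_S (∏_{i ∈ S} d i) · det A⟨S⟩`, where `A⟨S⟩` is the matrix whose rows
indexed by `S` are those of `A` and whose other rows are those of the identity
(multilinearity of the determinant in the rows). -/
theorem det_one_add_diagonal_mul_eq_sum_piecewise (d : ι → R) (A : Matrix ι ι R) :
    (1 + Matrix.diagonal d * A).det =
      ∑ s : Finset ι, (∏ i ∈ s, d i) * (Matrix.of (s.piecewise A (1 : Matrix ι ι R))).det := by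
  have hM : (1 + Matrix.diagonal d * A) =
      Matrix.of ((fun i => d i • A i) + fun i j => (1 : Matrix ι ι R) i j) := by
    ext i j
    simp [Matrix.diagonal_mul, Matrix.one_apply, add_comm]
  have hml := ((Matrix.detRowAlternating : (ι → R) [⋀^ι]→ₗ[R] R) :
      MultilinearMap R (fun _ : ι => ι → R) R).map_add_univ (fun i => d i • A i)
      (fun i j => (1 : Matrix ι ι R) i j)
  simp only [AlternatingMap.coe_multilinearMap] at hml
  rw [hM]
  change Matrix.detRowAlternating ((fun i => d i • A i) + fun i j => (1 : Matrix ι ι R) i j) = _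
  rw [hml]
  refine Finset.sum_congr rfl fun s _ => ?_
  have hps : s.piecewise (fun i => d i • A i) (fun i j => (1 : Matrix ι ι R) i j) =
      s.piecewise (fun i => d i • (s.piecewise A (1 : Matrix ι ι R)) i)
        (s.piecewise A (1 : Matrix ι ι R)) := by
    ext i j
    simp only [Finset.piecewise]
    split_ifs <;> rfl
  have hml2 := ((Matrix.detRowAlternating : (ι → R) [⋀^ι]→ₗ[R] R) :
      MultilinearMap R (fun _ : ι => ι → R) R).map_piecewise_smul d
      (s.piecewise A (1 : Matrix ι ι R)) s
  simp only [AlternatingMap.coe_multilinearMap] at hml2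
  rw [hps, hml2, smul_eq_mul]
  rfl

/-- Replacing the rows outside `S` by identity rows leaves the principal minor:
`det A⟨S⟩ = det A[S]` (block-triangular form after sorting the indices of `S` first). -/
theorem det_of_piecewise_one (s : Finset ι) (A : Matrix ι ι R) :
    (Matrix.of (s.piecewise A (1 : Matrix ι ι R))).det =
      (A.submatrix (Subtype.val : {i // i ∈ s} → ι) Subtype.val).det := by
  set M : Matrix ι ι R := Matrix.of (s.piecewise A (1 : Matrix ι ι R)) with hMdef
  set e := Equiv.sumCompl (fun i => i ∈ s) with hedef
  rw [← Matrix.det_submatrix_equiv_self e M]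
  have hblock : M.submatrix e e = Matrix.fromBlocks
      (A.submatrix Subtype.val Subtype.val)
      (A.submatrix (Subtype.val : {i // i ∈ s} → ι) (Subtype.val : {i // i ∉ s} → ι))
      0 (1 : Matrix {i // i ∉ s} {i // i ∉ s} R) := by
    ext (i | i) (j | j)
    · simp [M, e, Finset.piecewise, i.2]
    · simp [M, e, Finset.piecewise, i.2]
    · have hij : (i : ι) ≠ (j : ι) := fun h => i.2 (h ▸ j.2)
      simp [M, e, Finset.piecewise, i.2, hij]
    · simp [M, e, Finset.piecewise, i.2, Matrix.one_apply, Subtype.val_inj]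
  rw [hblock, Matrix.det_fromBlocks_zero₂₁, Matrix.det_one, mul_one]

/-- **Principal-minor expansion** of `det(1 + diag(d)·A)`:
`det(1 + diag(d)·A) = ∑_S (∏_{i∈S} d i) · det A[S]`, the sum over all subsets `S` of the index
type, `A[S]` the principal submatrix on `S`. -/
theorem det_one_add_diagonal_mul_eq_sum_minors (d : ι → R) (A : Matrix ι ι R) :
    (1 + Matrix.diagonal d * A).det =
      ∑ s : Finset ι, (∏ i ∈ s, d i) *
        (A.submatrix (Subtype.val : {i // i ∈ s} → ι) Subtype.val).det := by
  rw [det_one_add_diagonal_mul_eq_sum_piecewise]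
  simp_rw [det_of_piecewise_one]

end PrincipalMinorExpansion

section Cubic

/-- The squarefree monomial `∏_{i ∈ S} Xᵢ` times a constant is homogeneous of degree `#S`, so its
degree-`3` component is itself or `0` according as `#S = 3` or not. -/
theorem homogeneousComponent_three_prod_X_mul_C (s : Finset (Fin 3 × Fin 3)) (c : ℂ) :
    homogeneousComponent 3 ((∏ i ∈ s, (X i : MvPolynomial (Fin 3 × Fin 3) ℂ)) * C c) =
      if s.card = 3 then (∏ i ∈ s, (X i : MvPolynomial (Fin 3 × Fin 3) ℂ)) * C c else 0 := by
  have h1 : (∏ i ∈ s, (X i : MvPolynomial (Fin 3 × Fin 3) ℂ)).IsHomogeneous (∑ i ∈ s, 1) :=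
    IsHomogeneous.prod s (fun i => X i) (fun _ => 1) fun i _ => isHomogeneous_X ℂ i
  have h2 : ((∏ i ∈ s, (X i : MvPolynomial (Fin 3 × Fin 3) ℂ)) * C c).IsHomogeneous s.card := by
    have := h1.mul (isHomogeneous_C (Fin 3 × Fin 3) c)
    simpa using this
  rw [homogeneousComponent_of_mem h2]
  split_ifs <;> first | rfl | (exfalso; omega)

/-- **`3 × 3` principal minors of the board kernel.** Let `A₃ e e' = 0` if the cells `e, e'` of
the `3 × 3` board share a row or a column and `1` otherwise (the kernel of the route statement).
For three distinct cells `x, y, z`, the principal minor of `A₃` on `{x, y, z}` is `2` if the cells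
are pairwise non-attacking and `0` otherwise: with zero diagonal only the two `3`-cycle terms of
the Leibniz expansion survive, and by symmetry both equal `A₃ x y · A₃ y z · A₃ x z`. -/
theorem det_minor_three (x y z : Fin 3 × Fin 3) (hxy : x ≠ y) (hxz : x ≠ z) (hyz : y ≠ z) :
    ((Matrix.of fun e e' : Fin 3 × Fin 3 => if e.1 = e'.1 ∨ e.2 = e'.2 then (0 : ℂ) else 1).submatrix
        (Subtype.val : {i // i ∈ ({x, y, z} : Finset (Fin 3 × Fin 3))} → Fin 3 × Fin 3)
        Subtype.val).det =
      if ¬(x.1 = y.1 ∨ x.2 = y.2) ∧ ¬(x.1 = z.1 ∨ x.2 = z.2) ∧ ¬(y.1 = z.1 ∨ y.2 = z.2)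
      then 2 else 0 := by
  have hx : x ∈ ({x, y, z} : Finset (Fin 3 × Fin 3)) := by simp
  have hy : y ∈ ({x, y, z} : Finset (Fin 3 × Fin 3)) := by simp
  have hz : z ∈ ({x, y, z} : Finset (Fin 3 × Fin 3)) := by simp
  set f : Fin 3 → {i // i ∈ ({x, y, z} : Finset (Fin 3 × Fin 3))} :=
    ![⟨x, hx⟩, ⟨y, hy⟩, ⟨z, hz⟩] with hf
  have hf_bij : Function.Bijective f := by
    constructor
    · intro a b hab
      fin_cases a <;> fin_cases b <;> simp_all [f]
    · rintro ⟨w, hw⟩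
      simp only [Finset.mem_insert, Finset.mem_singleton] at hw
      rcases hw with rfl | rfl | rfl
      exacts [⟨0, rfl⟩, ⟨1, rfl⟩, ⟨2, rfl⟩]
  rw [← Matrix.det_submatrix_equiv_self (Equiv.ofBijective f hf_bij), Matrix.submatrix_submatrix]
  have hval : (Subtype.val ∘ (Equiv.ofBijective f hf_bij)) = ![x, y, z] := by
    funext k
    fin_cases k <;> rfl
  rw [hval, Matrix.det_fin_three]
  have eyx : (y.1 = x.1 ∨ y.2 = x.2) ↔ (x.1 = y.1 ∨ x.2 = y.2) := by
    constructor <;> rintro (h | h) <;> simp [h]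
  have ezx : (z.1 = x.1 ∨ z.2 = x.2) ↔ (x.1 = z.1 ∨ x.2 = z.2) := by
    constructor <;> rintro (h | h) <;> simp [h]
  have ezy : (z.1 = y.1 ∨ z.2 = y.2) ↔ (y.1 = z.1 ∨ y.2 = z.2) := by
    constructor <;> rintro (h | h) <;> simp [h]
  simp only [Matrix.submatrix_apply, Matrix.of_apply, Matrix.cons_val_zero, Matrix.cons_val_one,
    Matrix.cons_val_two, Matrix.head_cons, Matrix.tail_cons, eyx, ezx, ezy]
  by_cases hxy' : x.1 = y.1 ∨ x.2 = y.2 <;> by_cases hxz' : x.1 = z.1 ∨ x.2 = z.2 <;>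
    by_cases hyz' : y.1 = z.1 ∨ y.2 = z.2 <;> norm_num [hxy', hxz', hyz']

/-- Pairwise non-attacking, for a three-element set of cells, unfolded. -/
theorem pna_triple_iff (x y z : Fin 3 × Fin 3) (hxy : x ≠ y) (hxz : x ≠ z) (hyz : y ≠ z) :
    (∀ e ∈ ({x, y, z} : Finset (Fin 3 × Fin 3)), ∀ e' ∈ ({x, y, z} : Finset (Fin 3 × Fin 3)),
        e ≠ e' → ¬(e.1 = e'.1 ∨ e.2 = e'.2)) ↔
      (¬(x.1 = y.1 ∨ x.2 = y.2) ∧ ¬(x.1 = z.1 ∨ x.2 = z.2) ∧ ¬(y.1 = z.1 ∨ y.2 = z.2)) := by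
  constructor
  · intro h
    exact ⟨h x (by simp) y (by simp) hxy, h x (by simp) z (by simp) hxz,
      h y (by simp) z (by simp) hyz⟩
  · rintro ⟨h1, h2, h3⟩ e he e' he' hne
    simp only [Finset.mem_insert, Finset.mem_singleton] at he he'
    rcases he with rfl | rfl | rfl <;> rcases he' with rfl | rfl | rfl <;>
      first
      | exact absurd rfl hne
      | assumption
      | (rintro (h | h) <;> simp_all)

/-- The three-element sets of pairwise non-attacking cells of the `3 × 3` board (its transversals)
are exactly the graphs `{(σ i, i)}` of the six permutations `σ` of `Fin 3`. -/
theorem filter_transversal_eq_image_perm :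
    ((Finset.univ : Finset (Finset (Fin 3 × Fin 3))).filter fun s =>
        s.card = 3 ∧ ∀ e ∈ s, ∀ e' ∈ s, e ≠ e' → ¬(e.1 = e'.1 ∨ e.2 = e'.2)) =
      Finset.univ.image fun σ : Equiv.Perm (Fin 3) => Finset.univ.image fun i => (σ i, i) := by
  decide

/-- `per₃` as the sum of the monomials `x^S` over the graphs `S` of the permutations of `Fin 3`. -/
theorem perPoly_three_eq_sum_image :
    Literature.Computability.AlgebraicComplexity.perPoly (Fin 3) ℂ =
      ∑ s ∈ (Finset.univ.image fun σ : Equiv.Perm (Fin 3) =>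
          Finset.univ.image fun i => (σ i, i)),
        ∏ i ∈ s, (X i : MvPolynomial (Fin 3 × Fin 3) ℂ) := by
  rw [Finset.sum_image]
  · simp only [Literature.Computability.AlgebraicComplexity.perPoly, Matrix.permanent,
      Matrix.mvPolynomialX_apply]
    refine Finset.sum_congr rfl fun σ _ => ?_
    rw [Finset.prod_image]
    intro i _ j _ h
    exact (Prod.mk.inj h).2
  · intro σ _ τ _ h
    dsimp only at h
    refine Equiv.ext fun i => ?_
    have hi : (σ i, i) ∈ Finset.univ.image fun j => (τ j, j) := by
      rw [← h]
      exact Finset.mem_image_of_mem _ (Finset.mem_univ i)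
    obtain ⟨j, _, hj⟩ := Finset.mem_image.mp hi
    obtain ⟨h1, h2⟩ := Prod.mk.inj hj
    subst h2
    exact h1.symm

/-- The cubic component of a read-once determinant `det(1 + diag(x)·A)` on the `3 × 3` board is
`2·per₃` as soon as the `3 × 3` principal minors of `A` are `2` on transversal triples of cells and
`0` on all other triples of distinct cells. -/
theorem homogeneousComponent_three_det_eq (A : Matrix (Fin 3 × Fin 3) (Fin 3 × Fin 3) ℂ)
    (hA : ∀ x y z : Fin 3 × Fin 3, x ≠ y → x ≠ z → y ≠ z →
      (A.submatrix (Subtype.val : {i // i ∈ ({x, y, z} : Finset (Fin 3 × Fin 3))} → Fin 3 × Fin 3)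
          Subtype.val).det =
        if ¬(x.1 = y.1 ∨ x.2 = y.2) ∧ ¬(x.1 = z.1 ∨ x.2 = z.2) ∧ ¬(y.1 = z.1 ∨ y.2 = z.2)
        then 2 else 0) :
    homogeneousComponent 3 (1 + Matrix.diagonal (fun e : Fin 3 × Fin 3 => X e) *
        A.map (fun a : ℂ => (C a : MvPolynomial (Fin 3 × Fin 3) ℂ))).det =
      C (2 : ℂ) * Literature.Computability.AlgebraicComplexity.perPoly (Fin 3) ℂ := by
  rw [det_one_add_diagonal_mul_eq_sum_minors, map_sum]
  have hterm : ∀ s : Finset (Fin 3 × Fin 3),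
      homogeneousComponent 3 ((∏ i ∈ s, (X i : MvPolynomial (Fin 3 × Fin 3) ℂ)) *
        ((A.map fun a : ℂ => (C a : MvPolynomial (Fin 3 × Fin 3) ℂ)).submatrix
          (Subtype.val : {i // i ∈ s} → Fin 3 × Fin 3) Subtype.val).det) =
      if s.card = 3 then (∏ i ∈ s, (X i : MvPolynomial (Fin 3 × Fin 3) ℂ)) *
        C ((A.submatrix (Subtype.val : {i // i ∈ s} → Fin 3 × Fin 3) Subtype.val).det)
      else 0 := by
    intro s
    have hC : ((A.map fun a : ℂ => (C a : MvPolynomial (Fin 3 × Fin 3) ℂ)).submatrix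
          (Subtype.val : {i // i ∈ s} → Fin 3 × Fin 3) Subtype.val).det =
        C ((A.submatrix (Subtype.val : {i // i ∈ s} → Fin 3 × Fin 3) Subtype.val).det) := by
      rw [Matrix.submatrix_map, RingHom.map_det, RingHom.mapMatrix_apply]
    rw [hC]
    exact homogeneousComponent_three_prod_X_mul_C s _
  simp_rw [hterm]
  rw [← Finset.sum_filter]
  have hmin : ∀ s ∈ (Finset.univ : Finset (Finset (Fin 3 × Fin 3))).filter (fun s => s.card = 3),
      (∏ i ∈ s, (X i : MvPolynomial (Fin 3 × Fin 3) ℂ)) *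
        C ((A.submatrix (Subtype.val : {i // i ∈ s} → Fin 3 × Fin 3) Subtype.val).det) =
      if (∀ e ∈ s, ∀ e' ∈ s, e ≠ e' → ¬(e.1 = e'.1 ∨ e.2 = e'.2)) then
        (∏ i ∈ s, (X i : MvPolynomial (Fin 3 × Fin 3) ℂ)) * C 2 else 0 := by
    intro s hs
    obtain ⟨x, y, z, hxy, hxz, hyz, rfl⟩ := Finset.card_eq_three.mp (Finset.mem_filter.mp hs).2
    rw [hA x y z hxy hxz hyz]
    by_cases hp : ¬(x.1 = y.1 ∨ x.2 = y.2) ∧ ¬(x.1 = z.1 ∨ x.2 = z.2) ∧ ¬(y.1 = z.1 ∨ y.2 = z.2)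
    · rw [if_pos hp, if_pos ((pna_triple_iff x y z hxy hxz hyz).mpr hp)]
    · rw [if_neg hp, if_neg (mt (pna_triple_iff x y z hxy hxz hyz).mp hp), map_zero, mul_zero]
  rw [Finset.sum_congr rfl hmin, ← Finset.sum_filter, Finset.filter_filter, ← Finset.sum_mul,
    mul_comm, filter_transversal_eq_image_perm, perPoly_three_eq_sum_image]

/-- **`CubicReadOnce`** (route FreeFermionCLL, stmt-ValiantsHypothesis-13562):
`[deg 3] det(I₉ + diag(x)·A₃) = 2·per₃` — `per₃` is half the cubic component of the read-once
integer principal-minor polynomial whose kernel `A₃` is the adjacency matrix of the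
non-attacking-rooks graph of the `3 × 3` board. -/
theorem cubicReadOnce_proof :
    Summit.ValiantsHypothesis.ValiantsHypothesis.Theses.FreeFermionCLL.CubicReadOnce :=
  homogeneousComponent_three_det_eq _ det_minor_three

end Cubic

end Summit.ValiantsHypothesis.ValiantsHypothesis.Theorems.FreeFermionCLLCubicReadOnce
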